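import Summits.MatrixMultiplication.OmegaCensus.STPPVosperCoverStageZ
import Summits.MatrixMultiplication.OmegaCensus.STPPVosperSlackOneA2CoverRows

/-!
# ω-census (abelian STPP census): case-β tools for the exact-cover stage — the holed-window step with an escape clause, the Z-point list, the row checker (kernel)

HONEST FRAMING (pub-omega census; verbatim): lottery ticket; floor = certified bounds/negative ranges.
Census STRUCTURE (seat pub-omega-stpp-1 gen 31, 2026-08-28), family (b2).  In case β of the slack-1 laws (`|Bᵢ + V| = b + |V|`, Hamidoune–Rødseth side),
`Bᵢ = {β + k e′ : k ≤ b, k ≠ g₁}` and `V` is the window `{v + k e′ : k ≤ n}` minus one hole `v + hh e′`, so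
`Z° = H ∖ (Bᵢ + V)` has, relative to `z₀ = β + v` and the unit `u = e′⁻¹`, the value set `ZLof p n b hh g₀` = the residues `t < p` that are NOT a sum
`x + y` with `x ≤ b`, `x ≠ g₁ = b − 1 − g₀`, `y ≤ n`, `y ≠ hh`.  THIS FILE: `holed_ratio_val_mem_cover` (= `holed_ratio_val_mem` of `STPPVosperSlackOneSteps.lean`
whose table may let a configuration through by a clause `Q j hh g₀`, returning then `hh, g₀` and the hole), `ZLof`, and the β ROW CHECKER `bCoverRow` with its
specification (window + hole + greedy tiling as in `tableBeta`, then `j ∈ J` or the exact-cover search `existsCoverZ` fails).  Pure bookkeeping; nothing here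
is progress on `ω`.
-/

open Finset
open scoped Pointwise

namespace Summit.MatrixMultiplication.OmegaCensus.CubeNB

open Literature.Computability.AlgebraicComplexity
open Literature.Combinatorics.Additive
open Summit.MatrixMultiplication.OmegaCensus.STPPKneser

variable {p : ℕ} [hp : Fact p.Prime] {N : ℕ} {A B C : Fin N → Finset (ZMod p)}

/-- **Gapped tiles in a holed window, with an escape clause** (case β, the transport-and-table step; variant of `holed_ratio_val_mem`).  `Bᵢ = {β + k e′ : k ≤ b, k ≠ g₁}` with `g₁ < b` (`b ≥ 1`,
`e′ ≠ 0`), `V = W ⊔ SY ⊆ {v + k e′ : k ≤ n}` with `|V| = n`, `SY` the `m`-term progression of step `d ≠ 0` from `c₀`, `n + 1 + b ≤ p`, at most `n + 1`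
blocks; the case-β table may also let a configuration `(j, t, hh, g₀)` through by an arbitrary clause `Q j hh g₀`; then either `(e′⁻¹ d).val ∈ J`, or `Q` holds
at the actual configuration, whose hole `v + hh • e′` of `V` and tile index `g₀` (`b − g₁ = g₀ + 1`) are returned. [folklore] -/
theorem holed_ratio_val_mem_cover (hS : IsSTPP A B C) (i : Fin N) {e' β v d c₀ : ZMod p} {b g₁ n m : ℕ} (he' : e' ≠ 0) (hd : d ≠ 0)
    (hg₁ : g₁ < b) (hB : B i = apErase β e' (b + 1) g₁) {SY : Finset (ZMod p)} (hSY : SY = apFinset c₀ d m)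
    (hWV : Disjoint ((((A i) ×ˢ ((B i) ×ˢ (C i))).image fun q : ZMod p × ZMod p × ZMod p => (0 : ZMod p) + q.2.2 - q.1 - q.2.1)) SY)
    (hVsub : (((A i) ×ˢ ((B i) ×ˢ (C i))).image fun q : ZMod p × ZMod p × ZMod p => (0 : ZMod p) + q.2.2 - q.1 - q.2.1) ∪ SY ⊆
      apFinset v e' (n + 1))
    (hVcard : #((((A i) ×ˢ ((B i) ×ˢ (C i))).image fun q : ZMod p × ZMod p × ZMod p => (0 : ZMod p) + q.2.2 - q.1 - q.2.1) ∪ SY) = n)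
    (hnb : n + 1 + b ≤ p) (hPcard : #((A i) ×ˢ (C i)) ≤ n + 1) {J : Finset ℕ} {Q : ℕ → ℕ → ℕ → Prop}
    (htable : ∀ j < p, ∀ t < p, (∀ i < m, (t + j * i) % p < n + 1) → ∀ hh < n + 1, hh ∉ (range m).image (fun i => (t + j * i) % p) →
      ∀ g₀ < b, greedyTiles ((range (b + 1)).erase (g₀ + 1)) (n + 1)
        (((range (n + 1)).erase hh).filter fun x => x ∉ (range m).image fun i => (t + j * i) % p) = true → j ∈ J ∨ Q j hh g₀) :
    (e'⁻¹ * d).val ∈ J ∨ ∃ hh g₀ : ℕ, hh < n + 1 ∧ g₀ < b ∧ b - g₁ = g₀ + 1 ∧ Q (e'⁻¹ * d).val hh g₀ ∧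
      v + hh • e' ∉ (((A i) ×ˢ ((B i) ×ˢ (C i))).image fun q : ZMod p × ZMod p × ZMod p => (0 : ZMod p) + q.2.2 - q.1 - q.2.1) ∪ SY := by
  set W := ((A i) ×ˢ ((B i) ×ˢ (C i))).image fun q : ZMod p × ZMod p × ZMod p => (0 : ZMod p) + q.2.2 - q.1 - q.2.1 with hW
  obtain ⟨hWeq0, hPdisj0⟩ := W_eq_biUnion_blocks hS i
  rw [← hW] at hWeq0
  set P := (A i) ×ˢ (C i) with hP
  -- transport
  set u : ZMod p := e'⁻¹ with hu
  set w : ZMod p := -(u * v) with hw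
  have hu0 : u ≠ 0 := inv_ne_zero he'
  have hue : u * e' = 1 := inv_mul_cancel₀ he'
  have hφinj : Function.Injective (fun x : ZMod p => u * x + w) := affine_injective hu0 w
  have hφVsup : (apFinset v e' (n + 1)).image (fun x => u * x + w) = apFinset 0 1 (n + 1) := by
    rw [image_affine_apFinset, hue, hw, add_neg_cancel]
  set G : Finset ℕ := (range (b + 1)).erase (b - g₁) with hG
  have hG0 : 0 ∈ G := Finset.mem_erase.2 ⟨by omega, Finset.mem_range.2 (by omega)⟩
  have hGsub : G ⊆ range (b + 1) := Finset.erase_subset _ _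
  set gz : ZMod p × ZMod p → ZMod p := fun xc => u * ((xc.2 - xc.1) - β - b • e') + w with hgz
  have hφblk : ∀ xc : ZMod p × ZMod p,
      ((B i).image fun y => (xc.2 - xc.1) - y).image (fun x => u * x + w) = G.image (fun ii : ℕ => gz xc + (ii : ZMod p)) := by
    intro xc
    rw [hB, Finset.image_image]
    have h := image_sub_apErase_affine (β := β) (c := xc.2 - xc.1) (w := w) hue (le_of_lt hg₁)
    exact h
  set T := W.image (fun x => u * x + w) with hT
  have hTeq : T = P.biUnion fun xc => G.image (fun ii : ℕ => gz xc + (ii : ZMod p)) := by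
    rw [hT, hWeq0, Finset.biUnion_image]
    exact Finset.biUnion_congr rfl fun xc _ => hφblk xc
  have hTdisj : (P : Set (ZMod p × ZMod p)).PairwiseDisjoint fun xc => G.image (fun ii : ℕ => gz xc + (ii : ZMod p)) := by
    intro xc hxc xc' hxc' hne
    rw [Function.onFun, ← hφblk, ← hφblk]
    exact (Finset.disjoint_image hφinj).2 (hPdisj0 hxc hxc' hne)
  set S := SY.image (fun x => u * x + w) with hSdef
  have hSeq : S = apFinset (u * c₀ + w) (u * d) m := by rw [hSdef, hSY, image_affine_apFinset]
  set I := apFinset (0 : ZMod p) 1 (n + 1) with hI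
  set V' := (W ∪ SY).image (fun x => u * x + w) with hV'
  have hV'sub : V' ⊆ I := by
    rw [hV', ← hφVsup]; exact Finset.image_subset_image hVsub
  have hV'card : #V' = n := by rw [hV', Finset.card_image_of_injective _ hφinj, hVcard]
  have hn1 : n + 1 ≤ p := by omega
  have hIcard : #I = n + 1 := card_apFinset one_ne_zero hn1
  obtain ⟨h₀, hh₀⟩ : ∃ h₀, I \ V' = {h₀} := Finset.card_eq_one.1 (by rw [Finset.card_sdiff_of_subset hV'sub, hIcard, hV'card]; omega)
  have hh₀I : h₀ ∈ I := (Finset.mem_sdiff.1 (by rw [hh₀]; exact Finset.mem_singleton_self _)).1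
  have hh₀V : h₀ ∉ V' := (Finset.mem_sdiff.1 (by rw [hh₀]; exact Finset.mem_singleton_self _)).2
  have hV'TS : V' = T ∪ S := by rw [hV', hT, hSdef, Finset.image_union]
  have hTSdisj : Disjoint T S := by rw [hT, hSdef]; exact (Finset.disjoint_image hφinj).2 hWV
  have hTI : T ⊆ I := fun x hx => hV'sub (by rw [hV'TS]; exact Finset.mem_union_left _ hx)
  have hSI : S ⊆ I := fun x hx => hV'sub (by rw [hV'TS]; exact Finset.mem_union_right _ hx)
  -- the tiles, transported to ℕ
  have hwin : ∀ xc ∈ P, ∀ ii ∈ G, gz xc + (ii : ZMod p) ∈ apFinset (0 : ZMod p) 1 (n + 1) := by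
    intro xc hxc ii hii
    apply hTI
    rw [hTeq]
    exact Finset.mem_biUnion.2 ⟨xc, hxc, Finset.mem_image.2 ⟨ii, hii, rfl⟩⟩
  obtain ⟨hTval, hdisjℕ⟩ := val_image_tiles (n := n + 1) (b := b) hnb hGsub hG0 P gz hwin hTdisj
  have hgreedy0 := greedyTiles_of_tiling G hG0 (fun xc => (gz xc).val) (n + 1) P hPcard hdisjℕ
  rw [← hTval, ← hTeq] at hgreedy0
  -- identify T.image val with the table's set
  set t' : ZMod p := u * c₀ + w with ht'
  set j' : ZMod p := u * d with hj'
  have hj'0 : j' ≠ 0 := mul_ne_zero hu0 hd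
  have hposval : ∀ k, (t' + k • j').val = (t'.val + j'.val * k) % p := fun k => val_add_nsmul_zmod t' j' k
  have hSmem : ∀ y, y ∈ S ↔ ∃ k, k < m ∧ t' + k • j' = y := by
    intro y; rw [hSeq, mem_apFinset]
  have hXeq : T.image ZMod.val =
      ((range (n + 1)).erase h₀.val).filter fun x => x ∉ (range m).image fun k => (t'.val + j'.val * k) % p := by
    ext x
    simp only [Finset.mem_image, Finset.mem_filter, Finset.mem_erase, Finset.mem_range, not_exists, not_and]
    constructor
    · rintro ⟨y, hyT, rfl⟩
      have hyI : y ∈ I := hTI hyT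
      refine ⟨⟨fun heq => hh₀V ?_, (mem_apFinset_zero_one_iff hn1).1 hyI⟩, ?_⟩
      · have hy : y = h₀ := ZMod.val_injective p heq
        rw [hV'TS, ← hy]
        exact Finset.mem_union_left _ hyT
      · intro k hk hk'
        have hyS : y ∈ S := (hSmem y).2 ⟨k, hk, ZMod.val_injective p (by rw [hposval, hk'])⟩
        exact Finset.disjoint_left.1 hTSdisj hyT hyS
    · rintro ⟨⟨hne, hlt⟩, hnot⟩
      have hxp : x < p := by omega
      have hxval : (x : ZMod p).val = x := by rw [ZMod.val_natCast, Nat.mod_eq_of_lt hxp]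
      have hxI : (x : ZMod p) ∈ I := (mem_apFinset_zero_one_iff hn1).2 (by rw [hxval]; exact hlt)
      have hxh : (x : ZMod p) ≠ h₀ := fun h => hne (by rw [← h, hxval])
      have hxV' : (x : ZMod p) ∈ V' := by
        by_contra hxV'
        have : (x : ZMod p) ∈ I \ V' := Finset.mem_sdiff.2 ⟨hxI, hxV'⟩
        rw [hh₀, Finset.mem_singleton] at this
        exact hxh this
      rw [hV'TS, Finset.mem_union] at hxV'
      rcases hxV' with hxT | hxS
      · exact ⟨(x : ZMod p), hxT, hxval⟩
      · exfalso
        obtain ⟨k, hk, hkx⟩ := (hSmem _).1 hxS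
        exact hnot k hk (by rw [← hposval, hkx, hxval])
  rw [hXeq] at hgreedy0
  -- table
  have hwinS : ∀ k < m, (t'.val + j'.val * k) % p < n + 1 := by
    intro k hk
    rw [← hposval]
    exact (mem_apFinset_zero_one_iff hn1).1 (hSI ((hSmem _).2 ⟨k, hk, rfl⟩))
  have hh₀lt : h₀.val < n + 1 := (mem_apFinset_zero_one_iff hn1).1 hh₀I
  have hhole : h₀.val ∉ (range m).image fun k => (t'.val + j'.val * k) % p := by
    intro hmem
    obtain ⟨k, hk, hkx⟩ := Finset.mem_image.1 hmem
    have hmem' : h₀ ∈ S := (hSmem _).2 ⟨k, Finset.mem_range.1 hk, ZMod.val_injective p (by rw [hposval, hkx])⟩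
    exact hh₀V (by rw [hV'TS]; exact Finset.mem_union_right _ hmem')
  obtain ⟨g₀, hg₀⟩ : ∃ g₀, b - g₁ = g₀ + 1 := ⟨b - g₁ - 1, by omega⟩
  have hg₀b : g₀ < b := by omega
  rw [hG, hg₀] at hgreedy0
  rcases htable j'.val (ZMod.val_lt j') t'.val (ZMod.val_lt t') hwinS h₀.val hh₀lt hhole g₀ hg₀b hgreedy0 with hval | hQ
  · rw [hj'] at hval
    exact Or.inl hval
  · right
    refine ⟨h₀.val, g₀, hh₀lt, hg₀b, hg₀, by rw [hj'] at hQ; exact hQ, ?_⟩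
    -- the hole of `V`, pulled back from the window: `φ (v + h₀.val • e′) = h₀`
    intro hmem
    apply hh₀V
    rw [hV']
    refine Finset.mem_image.2 ⟨v + h₀.val • e', hmem, ?_⟩
    have : u * (v + h₀.val • e') + w = (h₀.val : ZMod p) := by
      rw [hw, nsmul_eq_mul]; linear_combination (h₀.val : ZMod p) * hue
    rw [this, ZMod.natCast_zmod_val]


/-! ## The Z-point list of case β and the row checker -/

/-- The Z-point values in case β: residues `t < p` that are not `x + y` with `x ≤ b`, `x ≠ b − 1 − g₀`, `y ≤ n`, `y ≠ hh`. [folklore] -/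
def ZLof (p n b hh g₀ : ℕ) : List ℕ :=
  (List.range p).filter fun t =>
    !((List.range (b + 1)).any fun x => (x != b - 1 - g₀) && (List.range (n + 1)).any fun y => (y != hh) && (x + y == t))

/-- Membership in `ZLof`. [folklore] -/
theorem mem_ZLof {p n b hh g₀ t : ℕ} :
    t ∈ ZLof p n b hh g₀ ↔ t < p ∧ ∀ x ≤ b, x ≠ b - 1 - g₀ → ∀ y ≤ n, y ≠ hh → x + y ≠ t := by
  rw [ZLof, List.mem_filter, List.mem_range]
  constructor
  · rintro ⟨htp, h⟩
    refine ⟨htp, fun x hx hxg y hy hyh hsum => ?_⟩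
    have hany : ((List.range (b + 1)).any fun x => (x != b - 1 - g₀) && (List.range (n + 1)).any fun y => (y != hh) && (x + y == t)) = true := by
      rw [List.any_eq_true]
      refine ⟨x, List.mem_range.2 (by omega), ?_⟩
      rw [Bool.and_eq_true, bne_iff_ne, List.any_eq_true]
      refine ⟨hxg, y, List.mem_range.2 (by omega), ?_⟩
      rw [Bool.and_eq_true, bne_iff_ne, beq_iff_eq]
      exact ⟨hyh, hsum⟩
    rw [hany] at h
    simp at h
  · rintro ⟨htp, h⟩
    refine ⟨htp, ?_⟩
    rw [Bool.not_eq_true', Bool.eq_false_iff]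
    intro hany
    rw [List.any_eq_true] at hany
    obtain ⟨x, hx, hx'⟩ := hany
    rw [Bool.and_eq_true, bne_iff_ne, List.any_eq_true] at hx'
    obtain ⟨hxg, y, hy, hy'⟩ := hx'
    rw [Bool.and_eq_true, bne_iff_ne, beq_iff_eq] at hy'
    rw [List.mem_range] at hx hy
    exact h x (by omega) hxg y (by omega) hy'.1 hy'.2

/-- **One row (`j` fixed) of the case-β table with the exact-cover stage** (`Bool`): as the `j`-th entry of `tableBeta p n₁ m b J`, but a configuration
`(t, hh, g₀)` passing the window, hole and greedy-tiling tests is admissible when `j ∈ J` OR the cover search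
`existsCoverZ p [(j k) mod p : k < L] (ZLof p (n₁ − 1) b hh g₀) blocks [] []` fails. [folklore] -/
def bCoverRow (p n₁ m b : ℕ) (J : Finset ℕ) (L : ℕ) (blocks : List (ℕ × ℕ × ℕ)) (j : ℕ) : Bool :=
  (List.range p).all fun t =>
    decide (j ∈ J) ||
    !((List.range m).all fun i => decide ((t + j * i) % p < n₁)) ||
    (List.range n₁).all fun h =>
      decide (h ∈ (range m).image fun i => (t + j * i) % p) ||
      (List.range b).all fun g₀ =>
        !(greedyTiles ((range (b + 1)).erase (g₀ + 1)) n₁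
            (((range n₁).erase h).filter fun x => x ∉ (range m).image fun i => (t + j * i) % p)) ||
        !(existsCoverZ p ((List.range L).map fun k => (j * k) % p) (ZLof p (n₁ - 1) b h g₀) blocks [] [])

/-- **Specification of the β row checker.** [folklore] -/
theorem bCoverRow_spec {p n₁ m b : ℕ} {J : Finset ℕ} {L : ℕ} {blocks : List (ℕ × ℕ × ℕ)} {j : ℕ}
    (h : bCoverRow p n₁ m b J L blocks j = true) :
    ∀ t < p, (∀ i < m, (t + j * i) % p < n₁) → ∀ hh < n₁, hh ∉ (range m).image (fun i => (t + j * i) % p) →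
      ∀ g₀ < b, greedyTiles ((range (b + 1)).erase (g₀ + 1)) n₁
        (((range n₁).erase hh).filter fun x => x ∉ (range m).image fun i => (t + j * i) % p) = true →
      j ∈ J ∨ existsCoverZ p ((List.range L).map fun k => (j * k) % p) (ZLof p (n₁ - 1) b hh g₀) blocks [] [] = false := by
  intro t ht hwin hh hhh hhole g₀ hg₀ htile
  rw [bCoverRow, List.all_eq_true] at h
  have h1 := h t (List.mem_range.2 ht)
  rw [Bool.or_eq_true, Bool.or_eq_true, decide_eq_true_eq] at h1
  rcases h1 with (hJ | hw) | h1
  · exact Or.inl hJ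
  · exfalso
    rw [Bool.not_eq_true', Bool.eq_false_iff] at hw
    apply hw
    rw [List.all_eq_true]
    intro i hi
    rw [decide_eq_true_eq]
    exact hwin i (List.mem_range.1 hi)
  rw [List.all_eq_true] at h1
  have h2 := h1 hh (List.mem_range.2 hhh)
  rw [Bool.or_eq_true, decide_eq_true_eq] at h2
  rcases h2 with hmem | h2
  · exact absurd hmem hhole
  rw [List.all_eq_true] at h2
  have h3 := h2 g₀ (List.mem_range.2 hg₀)
  rw [Bool.or_eq_true, Bool.not_eq_true', Bool.not_eq_true'] at h3
  rcases h3 with h4 | h4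
  · rw [htile] at h4; exact Bool.noConfusion h4
  · exact Or.inr h4

end Summit.MatrixMultiplication.OmegaCensus.CubeNB
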